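import Literature.AlgebraicGeometry.HodgeTheory.AbelianVarietyCotangentHodge
import Literature.AlgebraicGeometry.HodgeTheory.AbelianVarietyEndomorphismsHOne
import HarnessLib

/-!
# Sanity / non-vacuity of `cotangent_hodge10_comparison` on the scalar endomorphisms `[n]`

Family `hodge`, layer `Literature/AlgebraicGeometry/HodgeTheory`.  THEOREMS ONLY.  A kernel check of the
NORMALISATION and VARIANCE of the named fact `cotangent_hodge10_comparison`
(`HodgeTheory/AbelianVarietyCotangentHodge`): restricted to the multiplications `[n] = n • 𝟙 B`
(`n : ℤ`) the fact is a THEOREM of the tree — for every complex abelian variety `B` and the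
`(1,0)`-classes `W`, EVERY linear isomorphism `Ψ : T_e^*(B) ≃ W` (and there is one, by
`dim T_e^*(B) = dim B = dim W`) intertwines `T_e^*([n]) = n` (`cotangentMap_zsmul_id_eq_smul`,
[GortzWedhorn2020] Rem. 6.12 / the tree's `cotangentMap_zsmul_id_holds`) with `[n]^* = n` on `H¹`
([LangeBirkenhake1992] Lemma 1.1.17, [MumfordAV1970] §19; the tree's `complexBetti_map_zsmul_one`).
So the fact is satisfiable on the subring `ℤ · 1 ⊆ End B` of every `B` (in particular TRUE as stated for
a `B` all of whose endomorphisms are scalars), and its two sides scale by the SAME character `n ↦ n`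
(not `n²`, not `n̄`, not `n⁻¹`): both sides are pull-backs.  Red-team aid for audit point (R4) of TEAM
hCMisogE; nothing here is consumed by the `hCMisogE` chain.

## References

* [LangeBirkenhake1992] H. Lange, Ch. Birkenhake, *Complex Abelian Varieties* (1992), Lemma 1.1.17,
  §1.1.5 Lemma 1.1.22.
* [MumfordAV1970] D. Mumford, *Abelian Varieties* (1970), §19.
* [GortzWedhorn2020] U. Görtz, T. Wedhorn, *Algebraic Geometry I* (2nd ed. 2020), Remark 6.12.
-/

noncomputable section

open CategoryTheory

namespace Literature.AlgebraicGeometry.HodgeTheory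

open Literature.AlgebraicGeometry.Motives (AbelianVariety)

namespace cotangent_hodge10_comparison

variable {B : AbelianVariety ℂ} {W : Submodule ℂ (complexBetti B.X 1)}

/-- `[n]^* = n` on `H¹(B(ℂ); ℂ)`, element form with the `ModuleCat` spelling of the named fact.
[cite: LangeBirkenhake1992, Lemma 1.1.17] [cite: MumfordAV1970, §19] -/
theorem complexBetti_map_zsmul_id_hom_apply (n : ℤ) (c : complexBetti B.X 1) :
    (complexBetti.map (n • 𝟙 B).hom.hom.hom 1).hom c = (n : ℂ) • c := by
  have h := complexBetti_map_zsmul_id_add_zsmul_one (𝟙 B) n 0 c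
  rw [zero_smul, add_zero, Int.cast_zero, zero_smul, add_zero] at h
  exact h

/-- **Every** `Ψ : T_e^*(B) ≃ W` intertwines `T_e^*([n])` with `[n]^*|_W` (`n : ℤ`): both are the
scalar `n`. [cite: LangeBirkenhake1992, Lemma 1.1.17] [cite: GortzWedhorn2020, Remark 6.12] -/
theorem apply_cotangentMap_zsmul_id (Ψ : Motives.AbelianVariety.Cotangent B ≃ₗ[ℂ] W) (n : ℤ)
    (t : Motives.AbelianVariety.Cotangent B) :
    (Ψ (Motives.AbelianVariety.cotangentMap B (n • 𝟙 B) t) : complexBetti B.X 1) =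
      (complexBetti.map (n • 𝟙 B).hom.hom.hom 1).hom (Ψ t) := by
  rw [Motives.AbelianVariety.cotangentMap_zsmul_id_eq_smul, LinearMap.smul_apply, LinearMap.id_apply,
    map_smul, Submodule.coe_smul, complexBetti_map_zsmul_id_hom_apply]

/-- The `(1,0)`-classes are finite-dimensional (a submodule of the finite-dimensional `H¹(B(ℂ); ℂ)`,
`finite_complexBetti_abelianVariety`) — unconditionally. [folklore] -/
private theorem finite_of_mem_iff (_hW : ∀ v, v ∈ W ↔ IsOfHodgeType B.dim B.X 1 1 0 v) : Module.Finite ℂ W := by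
  haveI := finite_complexBetti_abelianVariety B 1
  infer_instance

/-- **The named fact holds on the scalars**: for every complex abelian variety `B` and the
`(1,0)`-classes `W` there IS a linear isomorphism `Ψ : T_e^*(B) ≃ W` (dimension count
`dim T_e^*(B) = dim B = h^{1,0}(B)`), and it intertwines `T_e^*([n])` with `[n]^*` for every `n : ℤ`.
Unconditional (no named fact used). [cite: LangeBirkenhake1992, Lemma 1.1.17 and §1.1.5 Lemma 1.1.22]
[cite: MumfordAV1970, §19] -/
theorem holds_on_zsmul_id (B : AbelianVariety ℂ) (W : Submodule ℂ (complexBetti B.X 1))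
    (hW : ∀ v, v ∈ W ↔ IsOfHodgeType B.dim B.X 1 1 0 v) :
    ∃ Ψ : Motives.AbelianVariety.Cotangent B ≃ₗ[ℂ] W,
      ∀ (n : ℤ) (t : Motives.AbelianVariety.Cotangent B),
        (Ψ (Motives.AbelianVariety.cotangentMap B (n • 𝟙 B) t) : complexBetti B.X 1) =
          (complexBetti.map (n • 𝟙 B).hom.hom.hom 1).hom (Ψ t) := by
  haveI := finite_of_mem_iff hW
  exact ⟨LinearEquiv.ofFinrankEq _ _ (finrank_eq_finrank_cotangent hW).symm,
    fun n t => apply_cotangentMap_zsmul_id _ n t⟩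

/-- Corollary: the named fact is TRUE AS STATED for every complex abelian variety all of whose
endomorphisms are scalars `[n]` (e.g. `End B = ℤ`). [cite: LangeBirkenhake1992, Lemma 1.1.17 and §1.1.5 Lemma 1.1.22] -/
theorem holds_of_forall_eq_zsmul_id (B : AbelianVariety ℂ) (hB : ∀ g : B ⟶ B, ∃ n : ℤ, g = n • 𝟙 B)
    (W : Submodule ℂ (complexBetti B.X 1)) (hW : ∀ v, v ∈ W ↔ IsOfHodgeType B.dim B.X 1 1 0 v) :
    ∃ Ψ : Motives.AbelianVariety.Cotangent B ≃ₗ[ℂ] W,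
      ∀ (g : B ⟶ B) (t : Motives.AbelianVariety.Cotangent B),
        (Ψ (Motives.AbelianVariety.cotangentMap B g t) : complexBetti B.X 1) =
          (complexBetti.map g.hom.hom.hom 1).hom (Ψ t) := by
  obtain ⟨Ψ, hΨ⟩ := holds_on_zsmul_id B W hW
  refine ⟨Ψ, fun g t => ?_⟩
  obtain ⟨n, rfl⟩ := hB g
  exact hΨ n t

end cotangent_hodge10_comparison

end Literature.AlgebraicGeometry.HodgeTheory

end
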